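import Mathlib.Algebra.MvPolynomial.Rename
import Mathlib.LinearAlgebra.Matrix.Permanent
import Mathlib.Data.Fintype.Card
import Literature.Computability.AlgebraicComplexity.OrbitClosure
import Literature.Computability.AlgebraicComplexity.DeterminantalComplexityProofs
import Literature.Computability.AlgebraicComplexity.StandardFamilies
import Literature.Computability.AlgebraicComplexity.ValiantClasses

/-!
# Border apolarity, crux `FixedWitnessObstructionQP` — de-padding the permanent is a projection

Route `ValiantsHypothesis/BorderApolarity`, crux item `stmt-ValiantsHypothesis-5778`, line
`toric-face-debordering`, stub `stub_unpad`: for `n ≤ m`, an affine determinantal expression of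
size `s` of the padded permanent `paddedPerPoly ℂ n m = X₀₀ ^ (m - n) · per_n` (a form in the `m²`
variables of the generic `m × m` matrix, `per_n` living on the bottom-right block
`BlockIdx n m = {i : Fin m // m - n ≤ i}`) yields one of `per_n = perPoly (Fin n) ℂ` in its own `n²`
variables, of the same size `s`.

Proof: `perPoly (Fin n) ℂ` is a Valiant projection (`IsProjection`) of `paddedPerPoly ℂ n m`:
substitute the block variable `(i, j)` by `X (e i, e j)` for a bijection `e : BlockIdx n m ≃ Fin n`
(`card_blockIdx`) and every other variable by the constant `1`.  The padding factor becomes `1`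
(for `n < m` the entry `(0,0)` is off the block and is sent to `C 1`; for `n = m` the exponent
`m - n` is `0`), the block permanent becomes `rename (Prod.map e e) (perPoly (BlockIdx n m) ℂ)`
(`MvPolynomial.aeval_rename`, `MvPolynomial.rename_eq_aeval`), and the generic permanent is
invariant under renaming rows and columns by the same bijection (`rename_prodMap_perPoly`,
reindexing the sum over permutations by `Equiv.permCongr e`).  Affine determinantal expressions
are stable under projections (`HasDetRepr.of_isProjection_holds`, Bürgisser 2000 §2.5).
-/

open MvPolynomial
open scoped BigOperators Matrix
open Literature.Computability.AlgebraicComplexity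

namespace Summit.ValiantsHypothesis.ValiantsHypothesis.Theorems.BorderApolarityFixedWitnessObstructionQP

/-- **The generic permanent is invariant under reindexing.**  Renaming the variables `X (i, j)` of
the generic permanent on the index type `α` along `Prod.map e e` for a bijection `e : α ≃ β` gives
the generic permanent on `β`: reindex the sum over permutations by `Equiv.permCongr e` and each
product by `e`. [folklore] -/
theorem rename_prodMap_perPoly {α β : Type*} [Fintype α] [DecidableEq α] [Fintype β]
    [DecidableEq β] (R : Type*) [CommSemiring R] (e : α ≃ β) :
    rename (Prod.map e e) (perPoly α R) = perPoly β R := by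
  rw [perPoly, perPoly, Matrix.permanent, Matrix.permanent, map_sum]
  simp only [map_prod, Matrix.mvPolynomialX_apply, rename_X, Prod.map_apply]
  rw [← Equiv.sum_comp (Equiv.permCongr e)]
  refine Finset.sum_congr rfl fun σ _ => ?_
  rw [← Equiv.prod_comp e]
  refine Finset.prod_congr rfl fun i _ => ?_
  rw [Equiv.permCongr_apply, Equiv.symm_apply_apply]

/-- **De-padding is a projection** (stub `stub_unpad` of line `toric-face-debordering`).  For
`n ≤ m`, an affine determinantal expression of size `s` of the padded permanent
`X₀₀ ^ (m - n) · per_n` in the `m²` variables of the generic `m × m` matrix yields one of `per_n` in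
its own `n²` variables, of the same size: `perPoly (Fin n) ℂ` is the Valiant projection of
`paddedPerPoly ℂ n m` under "block variable `(i, j) ↦ X (e i, e j)` (`e : BlockIdx n m ≃ Fin n`),
every other variable `↦ 1`", and affine determinantal expressions are stable under projections
(`HasDetRepr.of_isProjection_holds`; Bürgisser 2000, §2.5; Mulmuley–Sohoni 2001, §4 for the
padding). [folklore] -/
theorem stub_unpad : ∀ (n m : ℕ) [NeZero m], n ≤ m → ∀ s : ℕ,
    HasDetRepr (paddedPerPoly ℂ n m) s → HasDetRepr (perPoly (Fin n) ℂ) s := by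
  intro n m _ hnm s hpp
  -- a bijection between the block indices and `Fin n`
  let e : BlockIdx n m ≃ Fin n := Fintype.equivFinOfCardEq (card_blockIdx hnm)
  -- the substitution: block variables to the variables of `per_n`, everything else to `1`
  let a : Fin m × Fin m → MvPolynomial (Fin n × Fin n) ℂ := fun p =>
    if h : m - n ≤ (p.1 : ℕ) ∧ m - n ≤ (p.2 : ℕ) then X (e ⟨p.1, h.1⟩, e ⟨p.2, h.2⟩) else C 1
  have ha : ∀ p, (∃ q, a p = X q) ∨ ∃ c, a p = C c := by
    intro p
    by_cases h : m - n ≤ (p.1 : ℕ) ∧ m - n ≤ (p.2 : ℕ)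
    · exact Or.inl ⟨_, dif_pos h⟩
    · exact Or.inr ⟨1, dif_neg h⟩
  -- the padding factor is sent to `1`
  have h00 : a (0, 0) ^ (m - n) = 1 := by
    rcases Nat.eq_zero_or_pos (m - n) with h0 | hpos
    · rw [h0, pow_zero]
    · have h : ¬ (m - n ≤ (((0, 0) : Fin m × Fin m).1 : ℕ) ∧
          m - n ≤ (((0, 0) : Fin m × Fin m).2 : ℕ)) := by
        simp only [Fin.val_zero, Nat.le_zero, and_self]
        omega
      rw [show a (0, 0) = C 1 from dif_neg h, C_1, one_pow]
  -- on the block the substitution is the renaming along `Prod.map e e`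
  have hcomp : (a ∘ fun ij : BlockIdx n m × BlockIdx n m => ((ij.1 : Fin m), (ij.2 : Fin m))) =
      X ∘ Prod.map e e := by
    funext ij
    obtain ⟨i, j⟩ := ij
    simp only [Function.comp_apply, Prod.map_apply, a, dif_pos (And.intro i.2 j.2), Subtype.coe_eta]
  have hper : aeval a (paddedPerPoly ℂ n m) = perPoly (Fin n) ℂ := by
    rw [paddedPerPoly, map_mul, map_pow, aeval_X, h00, one_mul, aeval_rename, hcomp,
      ← rename_eq_aeval, rename_prodMap_perPoly]
  exact HasDetRepr.of_isProjection_holds hpp ⟨a, ha, hper.symm⟩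

end Summit.ValiantsHypothesis.ValiantsHypothesis.Theorems.BorderApolarityFixedWitnessObstructionQP
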